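import Summits.Ventures.PercRepro.GenQTenEightGapTraceT1
import Summits.Ventures.PercRepro.GenQTenEightGapTraceT2
import Summits.Ventures.PercRepro.GenQTenEightGapTraceT3
import Summits.Ventures.PercRepro.GenQTenEightGapTraceT4
import Summits.Ventures.PercRepro.GenQTenEightGapTraceT5
import Summits.Ventures.PercRepro.GenQTenEightGapTraceT6
import Summits.Ventures.PercRepro.GenQTenEightGapTraceT7

/-!
# PercRepro — the `(10, 8)` row: the trace residue assembled (night-4, gen 19 — modulo the gap)
-/
namespace PercRepro.Night4

open Finset ThmH SixFour GenQ PerFlat Star NightThree ThmN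

variable {α : Type} [DecidableEq α] {M : Matroid α} [M.Finite]

/-- **The trace residue `TraceSevenResidue` on a matroid with the seven hypotheses**: `interval_cases t` over the seven per-type modules. -/
theorem traceSeven_residue_of_hyps_of_gap (hres : TraceSevenResidual) (hs : Simple M) (hline : ∀ L ∈ flatsQ M 2, L.card ≤ 3) (hplane : ∀ P ∈ flatsQ M 3, P.card ≤ 6) (hsolid : ∀ F ∈ flatsQ M 4, F.card ≤ 10) (hflat5 : ∀ F ∈ flatsQ M 5, F.card ≤ 21) (hflat6 : ∀ F ∈ flatsQ M 6, F.card ≤ 43) (hflat7 : ∀ F ∈ flatsQ M 7, F.card ≤ 87) {H : Finset α} (hc : Core M 10) (hH : H ⊆ gr M) (hrH : M.eRk (H : Set α) = ((7 : ℕ) : ℕ∞)) (t : ℕ) (ht1 : 1 ≤ t) (ht : t ≤ 7) (hlo : 7 + t ≤ H.card) (hhi : H.card < traceSevenBound t) : 0 ≤ ∑ B ∈ Rq M H 7, ((((7 + 1 : ℕ) : ℚ) + 2 - ((t : ℕ) : ℚ)) * (1 / (2 + (mTr M B : ℚ))) - ((((7 + 1 : ℕ) : ℚ) + 2) / (((7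 + 1 : ℕ) : ℚ) + 1)) * GenQ.dem M H t B) := by
  unfold traceSevenBound at hhi
  interval_cases t <;> norm_num at hhi
  · exact traceSeven_residue_of_hyps_t1_of_gap hres hs hline hplane hsolid hflat5 hflat6 hflat7 hc hH hrH hlo hhi
  · exact traceSeven_residue_of_hyps_t2_of_gap hres hs hline hplane hsolid hflat5 hflat6 hflat7 hc hH hrH hlo hhi
  · exact traceSeven_residue_of_hyps_t3_of_gap hres hs hline hplane hsolid hflat5 hflat6 hflat7 hc hH hrH hlo hhi
  · exact traceSeven_residue_of_hyps_t4_of_gap hres hs hline hplane hsolid hflat5 hflat6 hflat7 hc hH hrH hlo hhi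
  · exact traceSeven_residue_of_hyps_t5_of_gap hres hs hline hplane hsolid hflat5 hflat6 hflat7 hc hH hrH hlo hhi
  · exact traceSeven_residue_of_hyps_t6_of_gap hres hs hline hplane hsolid hflat5 hflat6 hflat7 hc hH hrH hlo hhi
  · exact traceSeven_residue_of_hyps_t7_of_gap hres hs hline hplane hsolid hflat5 hflat6 hflat7 hc hH hrH hlo hhi

end PercRepro.Night4
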